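import Summits.Langlands.Langlands.Theses.QuarterDeficit1951
import Summits.Langlands.Langlands.Theorems.QuarterDeficit1951QuarterFingerprintDeficitStubOddConstantTerms

/-!
# `QuarterFingerprintDeficit` (stmt-Langlands-15897) — negative lemma modulo an ODD-SECTOR WINDOW CERTIFICATE

Line `Sketch` (lead c2 parity reshape, 2026-08-17) of crux stmt-Langlands-15897
`Summit.Langlands.Langlands.Theses.QuarterDeficit1951.QuarterFingerprintDeficit` (C1).

C1 says: for EVERY order-5 Dirichlet character `χ mod 1951` there is NO nonzero bounded `C²` function `u`
on `ℍ` with `(Δ + λ)u = 0`, `u (γ z) = χ(d_γ) u z` on `Γ₀(1951)`, zero constant terms at the cusps `∞` and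
`0`, `|λ − 1/4| ≤ 1/100`, joint `T_p`-eigen for `p ≤ 13` with `‖μ_p² χ̄(p) − φ‖ ≤ 1/100`, `φ ∈ Φ`.

The landed negative lemma `QuarterFingerprintDeficit_false_of_EvenIcosahedralMaassFormAt1951` (p128419)
takes as hypothesis the EXACT object (`λ = 1/4`, `μ_p² χ̄(p) ∈ Φ`, both constant-term clauses) — a shape no
finite computation certifies. Here the hypothesis is cut DOWN to the literal output of a ball-arithmetic
quasimode certificate run in the ODD sector of `(Γ₀(1951), χ)` (`OddWindowCertificate`): an odd
(`u(−z̄) = −u(z)`) bounded `C²` automorphic eigenfunction `u ≢ 0` with `|λ − 1/4| ≤ 1/100` whose six Hecke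
eigenvalues lie in boxes `‖μ_p − a_p‖ ≤ r_p` around centres `a_p` with `a_p² χ̄(p) ∈ Φ` and
`r_p (2‖a_p‖ + r_p) ≤ 1/100` — NO constant-term (cuspidality) clauses and NO exactness. The two dropped
clauses are supplied in-kernel by the landed stub `stub_oddConstantTerms` (p157357: odd + automorphic ⇒
`∫₀¹ u(x+iy) dx = 0` and `∫₀^{1951} u(S•(x+iy)) dx = 0`), and the box-to-fingerprint step is the algebra
`‖μ² c − a² c‖ = ‖μ − a‖ ‖μ + a‖ ≤ r (2‖a‖ + r)` with `‖c‖ = ‖χ̄(p)‖ = 1`.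

Why the odd sector: an order-5 character mod the prime 1951 is even, so both Eisenstein families of
`(Γ₀(1951), χ)` are invariant under `z ↦ −z̄` (landed `stub_eisenstein_even`, p157390, and `R ∘ W = W ∘ R`
for the Fricke involution), hence `L²_odd` is purely cuspidal and an odd quasimode certificate needs no
Eisenstein annihilator; the four numerically sighted `λ = 1/4` newforms (crux dir, SightingHejhalR0.md) are
odd. What is PROVED here (kernel-checked, no `sorry`): `OddWindowCertificate → ¬ C1`.
-/

-- `Summit.<Summit>.<Problem>`: for the single-conjunct summit `Langlands` the duplicate is mandated.
set_option linter.dupNamespace false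

namespace Summit.Langlands.Langlands.Theorems.QuarterFingerprintDeficit.Negative

open Summit.Langlands.Langlands.Theses.QuarterDeficit1951
open scoped ComplexConjugate

/-- **The odd-sector window certificate at conductor 1951** — the literal output of a ball-arithmetic
Booker–Strömbergsson–Venkatesh / Child-type quasimode certificate run in the ODD sector (no Eisenstein
annihilator): an order-5 `χ mod 1951`, an ODD (`u (J • z) = −u z`, `J • z = −z̄`) bounded `C²` function
`u ≢ 0` with `(Δ + λ) u = 0`, `u (γ z) = χ(d_γ) u z` on `Γ₀(1951)`, `|λ − 1/4| ≤ 1/100`, and, for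
`p ∈ {2,3,5,7,11,13}`, `T_p u = μ_p u` (classical unitary Hecke operator with nebentypus `χ`, verbatim the
route's `Tp`) with `‖μ_p − a_p‖ ≤ r_p` for some centre `a_p` with `a_p² χ̄(p) ∈ Φ = {0,1,4,(3±√5)/2}`,
`0 ≤ r_p` and `r_p (2‖a_p‖ + r_p) ≤ 1/100`. NO constant-term clauses (they follow from oddness). The `let`s
`Φ`, `P₀`, `Tp` are VERBATIM those of the route decl. A CONSTRUCTION hypothesis of verdict class
`computation`; not a published theorem, not provable in-kernel today (no spectral theory of
`L²(Γ₀(N)\ℍ, χ)` in Mathlib). -/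
def OddWindowCertificate : Prop :=
  let Φ : Set ℂ := {0, 1, 4, (((3 + Real.sqrt 5) / 2 : ℝ) : ℂ), (((3 - Real.sqrt 5) / 2 : ℝ) : ℂ)}; let P₀ : Finset ℕ := {2, 3, 5, 7, 11, 13}; let Tp : DirichletCharacter ℂ 1951 → ℕ → (UpperHalfPlane → ℂ) → UpperHalfPlane → ℂ := fun χ p u z => ((Real.sqrt p : ℝ) : ℂ)⁻¹ * ((∑ b ∈ Finset.range p, u (UpperHalfPlane.ofComplex (((z : ℂ) + b) / p))) + χ (p : ZMod 1951) * u (UpperHalfPlane.ofComplex ((p : ℂ) * z))); ∃ χ : DirichletCharacter ℂ 1951, orderOf χ = 5 ∧ ∃ (u : UpperHalfPlane → ℂ) (lam : ℝ), Literature.NumberTheory.Automorphic.IsC2 u ∧ (∀ z, Literature.NumberTheory.Automorphic.hypLaplacian u z + (lam : ℂ) * u z = 0) ∧ (∀ γ : Matrix.SpecialLinearGroup (Fin 2) ℤ, γ ∈ CongruenceSubgroup.Gamma0 1951 → ∀ z : UpperHalfPlane, u (γ • z) = χ ((γ 1 1 : ℤ) : ZMod 1951) * u z) ∧ (∃ C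 : ℝ, ∀ z, ‖u z‖ ≤ C) ∧ (∀ z : UpperHalfPlane, u (UpperHalfPlane.J • z) = - u z) ∧ (∃ z, u z ≠ 0) ∧ |lam - 1 / 4| ≤ 1 / 100 ∧ ∀ p ∈ P₀, ∃ (μ a : ℂ) (r : ℝ), a ^ 2 * conj (χ (p : ZMod 1951)) ∈ Φ ∧ 0 ≤ r ∧ r * (2 * ‖a‖ + r) ≤ 1 / 100 ∧ (∀ z, Tp χ p u z = μ * u z) ∧ ‖μ - a‖ ≤ r

/-- `‖χ(p)‖ = 1` at the six fingerprint primes (units modulo the prime 1951). [folklore] -/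
theorem norm_chi_eq_one_of_mem (χ : DirichletCharacter ℂ 1951) {p : ℕ}
    (hp : p ∈ ({2, 3, 5, 7, 11, 13} : Finset ℕ)) : ‖χ (p : ZMod 1951)‖ = 1 := by
  have hcop : Nat.Coprime p 1951 := by
    simp only [Finset.mem_insert, Finset.mem_singleton] at hp
    rcases hp with rfl | rfl | rfl | rfl | rfl | rfl <;> norm_num
  have h := χ.unit_norm_eq_one (ZMod.unitOfCoprime p hcop)
  rwa [ZMod.coe_unitOfCoprime] at h

/-- BOX ⇒ FINGERPRINT: a box `‖μ − a‖ ≤ r` with `r (2‖a‖ + r) ≤ 1/100` around a centre `a` and a unimodular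
`c` give `‖μ² c − a² c‖ ≤ 1/100` (`μ² c − a² c = (μ − a)(μ + a) c`). [folklore] -/
theorem norm_sq_mul_sub_sq_mul_le (μ a c : ℂ) (r : ℝ) (hc : ‖c‖ = 1) (hr0 : 0 ≤ r)
    (hr : r * (2 * ‖a‖ + r) ≤ 1 / 100) (hbox : ‖μ - a‖ ≤ r) :
    ‖μ ^ 2 * c - a ^ 2 * c‖ ≤ 1 / 100 := by
  have h1 : μ ^ 2 * c - a ^ 2 * c = (μ - a) * (μ + a) * c := by ring
  have h2 : ‖μ + a‖ ≤ r + 2 * ‖a‖ := by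
    have e : μ + a = (μ - a) + 2 * a := by ring
    calc ‖μ + a‖ = ‖(μ - a) + 2 * a‖ := by rw [← e]
      _ ≤ ‖μ - a‖ + ‖(2 : ℂ) * a‖ := norm_add_le _ _
      _ = ‖μ - a‖ + 2 * ‖a‖ := by rw [norm_mul, Complex.norm_two]
      _ ≤ r + 2 * ‖a‖ := by linarith
  rw [h1, norm_mul, norm_mul, hc, mul_one]
  calc ‖μ - a‖ * ‖μ + a‖ ≤ r * (r + 2 * ‖a‖) :=
        mul_le_mul hbox h2 (norm_nonneg _) hr0
    _ = r * (2 * ‖a‖ + r) := by ring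
    _ ≤ 1 / 100 := hr

/-- **`QuarterFingerprintDeficit` is false modulo an odd-sector window certificate.** From
`OddWindowCertificate` (an odd bounded `C²` automorphic eigenfunction `u ≢ 0` on `(Γ₀(1951), χ)`, `χ` of
order 5, in the window, with Hecke boxes around exactly fingerprinted centres) the crux fails: oddness gives
both constant-term clauses of the crux's `IsForm` (landed `stub_oddConstantTerms`), and the boxes give the
windowed fingerprint (`norm_sq_mul_sub_sq_mul_le` with `‖χ̄(p)‖ = 1`). ∃-intro against the route decl BY
NAME. -/
theorem QuarterFingerprintDeficit_false_of_OddWindowCertificate (H : OddWindowCertificate) :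
    ¬ QuarterFingerprintDeficit := by
  intro h₁
  obtain ⟨χ, hχ, u, lam, hC2, hΔ, haut, hbdd, hodd, hne, hwin, hfp⟩ := H
  obtain ⟨hct₁, hct₂⟩ := stub_oddConstantTerms χ u haut hodd
  refine h₁ χ hχ ⟨u, lam, ⟨hC2, hΔ, haut, hct₁, hct₂, hbdd⟩, hne, hwin, fun p hp => ?_⟩
  obtain ⟨μ, a, r, hφ, hr0, hr, hT, hbox⟩ := hfp p hp
  refine ⟨μ, a ^ 2 * conj (χ (p : ZMod 1951)), hφ, hT, ?_⟩
  have hc : ‖conj (χ (p : ZMod 1951))‖ = 1 := by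
    rw [Complex.norm_conj]; exact norm_chi_eq_one_of_mem χ hp
  exact norm_sq_mul_sub_sq_mul_le μ a _ r hc hr0 hr hbox

end Summit.Langlands.Langlands.Theorems.QuarterFingerprintDeficit.Negative
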